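import Summits.RiemannHypothesis.RiemannHypothesis.Theorems.Splittings.ScrewBridgeRawG3
import Summits.RiemannHypothesis.RiemannHypothesis.Theorems.IntegerScrewFozIndexBound
import HarnessLib

/-!
# Splittings — screw bridge, residual R1 DISCHARGED: `(FOZ ⟹ ETAIL) ⟺ FozNonsingular`, the FOZ-dichotomy,
# and T2 (`ETAIL ⟺ FOZ`) open at exactly R2 + R3 (SPLIT-screw-bridge gen 3, second pass; zero-definition raw form)

Cell rh-split, seat rh-split-screw-bridge g3 (brief sha16 f79c5f09d8bcb036), card
`run/shared/lean/pub/rh-split/cards/SPLIT-screw-bridge.md` §8-U; raw forms of `HOME/rh-split-screw-bridge/SplitScrewBridgeG3.lean`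
§8.6 (sha16 c43973341e3a81e2), filed by rh-split-typer-1 g2 on the lead's ruling 2026-08-26T20:45Z as a companion of
the landed `Splittings/ScrewBridgeRawG3.lean` (p465620; no room there under the 400-line rule).  The residual R1
«FOZ ⟹ bounded negative index of the screw Gram matrices» is the tree theorem
`IntegerScrew.FozIndexBound.fozIndexBound` (`Theorems/IntegerScrewFozIndexBound.lean`, p469353, standard axioms;
PIVOT-LAW §11 Thm 3(i)), so — with ETAIL = `∃ M₀, ∀ M ≥ M₀, 0 < screwPivot M`, FOZ = `CofiniteCriticalLine`, the
negative index `n₋(n) = #{i | λ_i(screwMatrix n) < 0}` written out —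

* `inertiaOfFoz_iff_fozNonsingular` — the bridge `FOZ ⟹ ETAIL` is EXACTLY the nonsingularity residual R2
  (`FOZ ⟹ screwDet n ≠ 0` eventually); `foz_negIndex_eventually_const` — under FOZ the negative index freezes;
* `foz_dichotomy` — given FOZ, either ETAIL or the screw matrices are singular infinitely often (the ∃-tail can fail
  only by DEGENERACY, never by sign oscillation at nonsingular levels); `etail_of_foz_of_nonsingular`;
* `etail_iff_foz_of` — T2 `ETAIL ⟺ FOZ` modulo exactly R3 (`IndexTransfer`: a bounded negative index forces FOZ;
  PIVOT-LAW Lemma U, NOT a tree theorem) and R2 (`FozNonsingular`, PIVOT-LAW Thm 4, NOT a tree theorem);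
* `etail_of_uniform_kiKimLee_of_nonsingular` — the uniform Ki–Kim–Lee door lands on the screw ∃-tail modulo R2
  alone; `boundedScrewIndex_tuple_of_foz` — FOZ ⟹ SPLIT-screw-finite's tuple-form bounded index, unconditionally
  as an implication.

Label (referee rh-split-ref g0 20:54Z on §8-U, lead 20:45Z): R1 closed in kernel; class of the row UNCHANGED
(barrier-note: the ∃-tail door is the FOZ costume; BombieriScrew = X-1 in screw clothing, CONDITIONAL).  Typer
replay (rh-split-typer-1 g2): farm rc 0, 0 warnings, 0 sorry, std axioms.  Everything here is RH-free bookkeeping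
GIVEN FOZ.

HONEST LABEL: SPLITTING SEARCH over kernel-typed RH-EQUIVALENCES; a splitting A ∧ B ⟹ RH is CONDITIONAL
bookkeeping unless A and B are both proved; nothing here bears on the truth of RH.
-/

set_option linter.dupNamespace false

noncomputable section

namespace Summit.RiemannHypothesis.RiemannHypothesis.Theorems.Splittings.ScrewBridgeFozConsequences

open Finset Matrix
open Literature.NumberTheory.LFunctions
open Summit.RiemannHypothesis.RiemannHypothesis.Theses.RuelleBand
open Summit.RiemannHypothesis.RiemannHypothesis.Theorems.IntegerScrew
open Summit.RiemannHypothesis.RiemannHypothesis.Theorems.Splittings.ScrewBridgeRawG3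
open Summit.RiemannHypothesis.Cruxes.CofiniteCriticalLine.Negative

/-! ## Consequences of `fozIndexBound` (R1 discharged) -/

section FozConsequences

open Summit.RiemannHypothesis.RiemannHypothesis.Theorems.IntegerScrew.FozIndexBound

/-- Under FOZ the negative index of the screw matrices freezes at some level (bounded + monotone). [folklore] -/
theorem foz_negIndex_eventually_const (hfoz : CofiniteCriticalLine) :
    ∃ N k : ℕ, ∀ n : ℕ, N ≤ n → (Finset.univ.filter fun i => (screwMatrix_isHermitian n).eigenvalues i < 0).card = k :=
  nat_eventually_const_of_monotone_bounded (fun n => (Finset.univ.filter fun i => (screwMatrix_isHermitian n).eigenvalues i < 0).card) (fun _ _ hab => negIndex_mono hab)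
    (fozIndexBound hfoz)

/-- **The bridge is now exactly the nonsingularity residual**: `(FOZ ⟹ ETAIL) ⟺ (FOZ ⟹ screw matrices
eventually nonsingular)` (`inertiaOfFoz_iff` with R1 discharged by `fozIndexBound`). [folklore] -/
theorem inertiaOfFoz_iff_fozNonsingular :
    (CofiniteCriticalLine → (∃ M₀ : ℕ, ∀ M : ℕ, M₀ ≤ M → 0 < screwPivot M)) ↔ (CofiniteCriticalLine → (∃ N : ℕ, ∀ n : ℕ, N ≤ n → screwDet n ≠ 0)) :=
  ⟨fun h => (inertiaOfFoz_iff.mp h).2, fun h => inertiaOfFoz_iff.mpr ⟨fun hf => fozIndexBound hf, h⟩⟩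

/-- FOZ and eventual nonsingularity of the screw matrices give the screw ∃-tail. [folklore] -/
theorem etail_of_foz_of_nonsingular (hfoz : CofiniteCriticalLine) (hns : (∃ N : ℕ, ∀ n : ℕ, N ≤ n → screwDet n ≠ 0)) : (∃ M₀ : ℕ, ∀ M : ℕ, M₀ ≤ M → 0 < screwPivot M) :=
  etail_of_boundedIndex_of_nonsingular (fozIndexBound hfoz) hns

/-- **FOZ-dichotomy for the screw ladder**: given finitely many off-line zeros, either the pivots are
eventually positive (ETAIL) or the screw matrices are singular infinitely often — under FOZ the ∃-tail can fail
only by DEGENERACY, never by sign oscillation at nonsingular levels. [folklore] -/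
theorem foz_dichotomy (hfoz : CofiniteCriticalLine) :
    (∃ M₀ : ℕ, ∀ M : ℕ, M₀ ≤ M → 0 < screwPivot M) ∨ ∀ N : ℕ, ∃ n : ℕ, N ≤ n ∧ screwDet n = 0 := by
  by_cases hns : ∃ N : ℕ, ∀ n : ℕ, N ≤ n → screwDet n ≠ 0
  · exact Or.inl (etail_of_foz_of_nonsingular hfoz hns)
  · right
    intro N
    by_contra h
    push Not at h
    exact hns ⟨N, fun n hn hdet => h n hn hdet⟩

/-- `ETAIL ⟺ FOZ` given only the two remaining residuals R3 (`IndexTransfer`: a bounded negative index forces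
FOZ) and R2 (`FozNonsingular`). -/
theorem etail_iff_foz_of
    (hT : (∃ K : ℕ, ∀ n : ℕ, (Finset.univ.filter fun i => (screwMatrix_isHermitian n).eigenvalues i < 0).card ≤ K) → CofiniteCriticalLine)
    (h2 : CofiniteCriticalLine → (∃ N : ℕ, ∀ n : ℕ, N ≤ n → screwDet n ≠ 0)) :
    (∃ M₀ : ℕ, ∀ M : ℕ, M₀ ≤ M → 0 < screwPivot M) ↔ CofiniteCriticalLine :=
  etail_iff_foz_of_residuals hT (fun hf => fozIndexBound hf) h2

/-- The uniform Ki–Kim–Lee door lands on the screw ∃-tail modulo R2 (`FozNonsingular`) alone.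
[cite: KiKimLee2009, Thm. 1.3] -/
theorem etail_of_uniform_kiKimLee_of_nonsingular
    (h2 : CofiniteCriticalLine → (∃ N : ℕ, ∀ n : ℕ, N ≤ n → screwDet n ≠ 0)) {T δ : ℝ} (hδ : 0 < δ)
    (h : ∀ t : ℝ, 0 < t → t < δ → ∀ z : ℂ, deBruijnH t z = 0 → T ≤ |z.re| → z.im = 0) : (∃ M₀ : ℕ, ∀ M : ℕ, M₀ ≤ M → 0 < screwPivot M) :=
  etail_of_uniform_kiKimLee (fun hf => fozIndexBound hf) h2 hδ h

/-- **FOZ ⟹ SPLIT-screw-finite's tuple-form `BoundedScrewIndex`** (their residual, now an unconditional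
implication). [folklore] -/
theorem boundedScrewIndex_tuple_of_foz (hfoz : CofiniteCriticalLine) :
    ∃ N : ℕ, ∀ n : ℕ, ∀ v : Fin (N + 1) → (Fin n → ℝ),
      ∃ c : Fin (N + 1) → ℝ, c ≠ 0 ∧
        0 ≤ star (∑ i, c i • v i) ⬝ᵥ ((screwMatrix n).mulVec (∑ i, c i • v i)) :=
  boundedScrewIndex_tuple_iff.mpr (fozIndexBound hfoz)

end FozConsequences

end Summit.RiemannHypothesis.RiemannHypothesis.Theorems.Splittings.ScrewBridgeFozConsequences

end
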